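import Summits.CriticalPhenomena.PercolationContinuityZ3.Theorems.PercNearOneGluingNoHeavyLowerTailDConeReduction
import Summits.CriticalPhenomena.PercolationContinuityZ3.Theorems.PercNearOneGluingAdditiveGluingBlockGrowth
import HarnessLib

/-!
# `NoHeavyLowerTail` (stmt-CriticalPhenomena-4575): the SIMULTANEOUS EXCHANGE inequality implies the D-cone

Support file (`--supports stmt-CriticalPhenomena-4575`), route task `nh-dp-commonrelay`, gen 2.  No definitions, no named facts.

Every landed proof step of the Kozma–Nitzan Q9 line is a two-cluster EXCHANGE `a₀ → c` for ONE competitor relay `c` (KN Lemma 3 /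
`SandwichSet.lemma3_sandwich_set`), and charging the debts relay by relay over-demands the credit by the multi-hit excess
(`blockGood_multiHit`).  The natural conjectural multi-relay replacement — this generation's candidate, 0 violations under random and
adversarial exact search on `n ≤ 8`, `|A ∖ b| ≤ 5` — is the SIMULTANEOUS exchange against ALL competitors at once:

* **SIMEX** (`Simex` below; block form, `u/S` = `S` glued, `A' = A ∖ {a₀, b}`, `a₀` a minimiser of `a ↦ μ_u(a ↔ b)` over `A`):
  `μ_{u/S}((S ↔ A') ∩ (a₀ ↔ b) ∩ (S ↮ a₀)) ≤ μ_{u/S}((S ↔ b) ∩ (S ↔ A') ∩ (S ↮ a₀))`, i.e. on the event that the block's cluster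
  captures SOME competitor relay and misses `a₀`, `b` is more likely captured by the block than joined to `a₀`.  For one competitor it IS the
  landed sandwich exchange; for two competitors it reads `AX₁ + AX₂ + DBL ≥ 0` (the two "avoidance exchanges", each of which can be
  negative, are paid by the double-capture credit).
* `dcone_of_simex` (**this file**): SIMEX ⇒ the D-cone (`stub_dcone`, block form of KN (41)); the difference is only the credit
  `μ(S ↔ b, S ↔ a₀)` and the split of `(S ↔ A) ∩ (a₀ ↔ b)` along `S ↔ a₀`.  Hence SIMEX ⇒ `NoHeavyLowerTail` (`noHeavyLowerTail_of_simex`,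
  through the landed `noHeavyLowerTail_of_dcone`) and ⇒ `AdditiveGluing` (`additiveGluing_of_dcone`).
So a prover of the line may aim at SIMEX (registered as `stub_simex`), a statement with the same event on both sides.
[cite: KozmaNitzan2024, Lemma 3 (pp. 6–7), Question 9 (p. 36)]
-/

namespace Summit.CriticalPhenomena.PercolationContinuityZ3.Theorems

open MeasureTheory Set
open Literature.Probability.LatticeModels (prodBernoulli)
open Literature.Probability.Percolation (BondConfig openConn openConnIn openGraph openCluster)
open scoped BigOperators

noncomputable section
open Classical

section SimexReduction
open Literature.Probability.LatticeModels Literature.Probability.Percolation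

/-- **SIMEX ⇒ D-cone, instance-wise.**  For a weighting `w` (in the application `w = u/S`), relays `A ∋ b, a₀` and a block `S`:
if `μ_w((S ↔ A∖{a₀,b}) ∩ (a₀ ↔ b) ∩ (S ↮ a₀)) ≤ μ_w((S ↔ b) ∩ (S ↔ A∖{a₀,b}) ∩ (S ↮ a₀))` then
`μ_w((S ↔ A) ∩ (a₀ ↔ b)) ≤ μ_w(S ↔ b)`.  Pure event bookkeeping: `(S↔A) ∩ (a₀↔b)` splits along `S ↔ a₀` into a part inside
`(S↔b) ∩ (S↔a₀)` and a part inside the left side of SIMEX, whose right side lies in `(S↔b) ∩ (S↮a₀)`. [folklore] -/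
theorem dKernel_of_simex_instance {n : ℕ} (w : Sym2 (Fin n) → unitInterval) (A S : Finset (Fin n)) (b a₀ : Fin n)
    (hb : b ∈ A)
    (hS : (prodBernoulli w).real
            ((⋃ v ∈ S, ⋃ a ∈ (A.erase b).erase a₀, (openConn v a : Set (BondConfig (Fin n)))) ∩ openConn a₀ b
              ∩ ⋂ v ∈ S, (openConn v a₀)ᶜ)
          ≤ (prodBernoulli w).real
            ((⋃ v ∈ S, (openConn v b : Set (BondConfig (Fin n)))) ∩ (⋃ v ∈ S, ⋃ a ∈ (A.erase b).erase a₀, openConn v a)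
              ∩ ⋂ v ∈ S, (openConn v a₀)ᶜ)) :
    (prodBernoulli w).real ((⋃ v ∈ S, ⋃ a ∈ A, (openConn v a : Set (BondConfig (Fin n)))) ∩ openConn a₀ b)
      ≤ (prodBernoulli w).real (⋃ v ∈ S, (openConn v b : Set (BondConfig (Fin n)))) := by
  set μ := prodBernoulli w with hμ
  set SB : Set (BondConfig (Fin n)) := ⋃ v ∈ S, (openConn v b : Set (BondConfig (Fin n))) with hSB
  set SA0 : Set (BondConfig (Fin n)) := ⋃ v ∈ S, (openConn v a₀ : Set (BondConfig (Fin n))) with hSA0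
  set L : Set (BondConfig (Fin n)) := (⋃ v ∈ S, ⋃ a ∈ A, (openConn v a : Set (BondConfig (Fin n)))) ∩ openConn a₀ b with hL
  set LS : Set (BondConfig (Fin n)) := (⋃ v ∈ S, ⋃ a ∈ (A.erase b).erase a₀, (openConn v a : Set (BondConfig (Fin n))))
      ∩ openConn a₀ b ∩ ⋂ v ∈ S, (openConn v a₀)ᶜ with hLS
  set RS : Set (BondConfig (Fin n)) := SB ∩ (⋃ v ∈ S, ⋃ a ∈ (A.erase b).erase a₀, (openConn v a : Set (BondConfig (Fin n))))
      ∩ ⋂ v ∈ S, (openConn v a₀)ᶜ with hRS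
  have hms : ∀ s : Set (BondConfig (Fin n)), MeasurableSet s := fun s => (Set.toFinite s).measurableSet
  -- (1) split `L` along `SA0`
  have hsplit : μ.real L = μ.real (L ∩ SA0) + μ.real (L \ SA0) :=
    (measureReal_inter_add_sdiff (hms SA0) (measure_ne_top _ _)).symm
  -- (2) `L ∩ SA0 ⊆ SB ∩ SA0`
  have h1 : L ∩ SA0 ⊆ SB ∩ SA0 := by
    rintro ω ⟨⟨_, hab⟩, hSa⟩
    refine ⟨?_, hSa⟩
    simp only [hSA0, Set.mem_iUnion, exists_prop] at hSa
    obtain ⟨v, hv, hva⟩ := hSa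
    simp only [hSB, Set.mem_iUnion, exists_prop]
    exact ⟨v, hv, blockGrowth_openConn_trans hva hab⟩
  -- (3) `L \ SA0 ⊆ LS`
  have h2 : L \ SA0 ⊆ LS := by
    rintro ω ⟨⟨hSA, hab⟩, hnSa⟩
    have hnv : ∀ v ∈ S, ω ∉ (openConn v a₀ : Set (BondConfig (Fin n))) := by
      intro v hv hva
      exact hnSa (by simp only [hSA0, Set.mem_iUnion, exists_prop]; exact ⟨v, hv, hva⟩)
    simp only [Set.mem_iUnion, exists_prop] at hSA
    obtain ⟨v, hv, a, ha, hva⟩ := hSA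
    have hane : a ≠ a₀ := by
      rintro rfl; exact hnv v hv hva
    have hanb : a ≠ b := by
      rintro rfl
      exact hnv v hv (blockGrowth_openConn_trans hva (blockGrowth_openConn_symm hab))
    refine ⟨⟨?_, hab⟩, ?_⟩
    · simp only [Set.mem_iUnion, exists_prop]
      exact ⟨v, hv, a, Finset.mem_erase.2 ⟨hane, Finset.mem_erase.2 ⟨hanb, ha⟩⟩, hva⟩
    · simp only [Set.mem_iInter]
      intro v' hv'
      exact hnv v' hv'
  -- (4) `RS ⊆ SB \ SA0`
  have h3 : RS ⊆ SB \ SA0 := by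
    rintro ω ⟨⟨hSb, _⟩, hnS⟩
    refine ⟨hSb, ?_⟩
    intro hSa
    simp only [hSA0, Set.mem_iUnion, exists_prop] at hSa
    obtain ⟨v, hv, hva⟩ := hSa
    simp only [Set.mem_iInter] at hnS
    exact hnS v hv hva
  -- (5) assemble
  have hsplitR : μ.real SB = μ.real (SB ∩ SA0) + μ.real (SB \ SA0) :=
    (measureReal_inter_add_sdiff (hms SA0) (measure_ne_top _ _)).symm
  have e1 : μ.real (L ∩ SA0) ≤ μ.real (SB ∩ SA0) := measureReal_mono h1 (measure_ne_top _ _)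
  have e2 : μ.real (L \ SA0) ≤ μ.real LS := measureReal_mono h2 (measure_ne_top _ _)
  have e3 : μ.real RS ≤ μ.real (SB \ SA0) := measureReal_mono h3 (measure_ne_top _ _)
  have e4 : μ.real LS ≤ μ.real RS := hS
  linarith

/-- **SIMEX ⇒ D-cone** at the level of the ∀-closed statements (glued weighting `u/S`, minimality carried along unchanged).
[cite: KozmaNitzan2024, Question 9 (p. 36)] -/
theorem dcone_of_simex
    (hSX : ∀ (n : ℕ) (u : Sym2 (Fin n) → unitInterval) (A S : Finset (Fin n)) (b a₀ : Fin n),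
      b ∈ A → Disjoint S A → a₀ ∈ A →
      (∀ a ∈ A, (prodBernoulli u).real (openConn a₀ b) ≤ (prodBernoulli u).real (openConn a b)) →
      (prodBernoulli (fun e : Sym2 (Fin n) => if (∀ y ∈ e, y ∈ S) ∧ ¬ e.IsDiag then 1 else u e)).real
          ((⋃ v ∈ S, ⋃ a ∈ (A.erase b).erase a₀, openConn v a) ∩ openConn a₀ b ∩ ⋂ v ∈ S, (openConn v a₀)ᶜ)
        ≤ (prodBernoulli (fun e : Sym2 (Fin n) => if (∀ y ∈ e, y ∈ S) ∧ ¬ e.IsDiag then 1 else u e)).real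
          ((⋃ v ∈ S, openConn v b) ∩ (⋃ v ∈ S, ⋃ a ∈ (A.erase b).erase a₀, openConn v a)
            ∩ ⋂ v ∈ S, (openConn v a₀)ᶜ)) :
    ∀ (n : ℕ) (u : Sym2 (Fin n) → unitInterval) (A S : Finset (Fin n)) (b a₀ : Fin n),
      b ∈ A → Disjoint S A → a₀ ∈ A →
      (∀ a ∈ A, (prodBernoulli u).real (openConn a₀ b) ≤ (prodBernoulli u).real (openConn a b)) →
      (prodBernoulli (fun e : Sym2 (Fin n) => if (∀ y ∈ e, y ∈ S) ∧ ¬ e.IsDiag then 1 else u e)).real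
          ((⋃ v ∈ S, ⋃ a ∈ A, openConn v a) ∩ openConn a₀ b)
        ≤ (prodBernoulli (fun e : Sym2 (Fin n) => if (∀ y ∈ e, y ∈ S) ∧ ¬ e.IsDiag then 1 else u e)).real
          (⋃ v ∈ S, openConn v b) :=
  fun n u A S b a₀ hb hSA ha₀ hmin =>
    dKernel_of_simex_instance _ A S b a₀ hb (hSX n u A S b a₀ hb hSA ha₀ hmin)

/-- **SIMEX ⇒ `NoHeavyLowerTail`** (crux stmt-CriticalPhenomena-4575, route `PercNearOneGluing`), via `dcone_of_simex` and the landed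
`noHeavyLowerTail_of_dcone`. [cite: KozmaNitzan2024, Conjecture 3 (p. 15), Question 9 (p. 36)] -/
theorem noHeavyLowerTail_of_simex
    (hSX : ∀ (n : ℕ) (u : Sym2 (Fin n) → unitInterval) (A S : Finset (Fin n)) (b a₀ : Fin n),
      b ∈ A → Disjoint S A → a₀ ∈ A →
      (∀ a ∈ A, (prodBernoulli u).real (openConn a₀ b) ≤ (prodBernoulli u).real (openConn a b)) →
      (prodBernoulli (fun e : Sym2 (Fin n) => if (∀ y ∈ e, y ∈ S) ∧ ¬ e.IsDiag then 1 else u e)).real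
          ((⋃ v ∈ S, ⋃ a ∈ (A.erase b).erase a₀, openConn v a) ∩ openConn a₀ b ∩ ⋂ v ∈ S, (openConn v a₀)ᶜ)
        ≤ (prodBernoulli (fun e : Sym2 (Fin n) => if (∀ y ∈ e, y ∈ S) ∧ ¬ e.IsDiag then 1 else u e)).real
          ((⋃ v ∈ S, openConn v b) ∩ (⋃ v ∈ S, ⋃ a ∈ (A.erase b).erase a₀, openConn v a)
            ∩ ⋂ v ∈ S, (openConn v a₀)ᶜ)) :
    Summit.CriticalPhenomena.PercolationContinuityZ3.Theses.PercNearOneGluing.NoHeavyLowerTail :=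
  noHeavyLowerTail_of_dcone (dcone_of_simex hSX)

/-- Same, typed against the sibling route `PercNearOneGluingNoHeavy`. [cite: KozmaNitzan2024, Conjecture 3 (p. 15)] -/
theorem noHeavyLowerTail_noHeavy_of_simex
    (hSX : ∀ (n : ℕ) (u : Sym2 (Fin n) → unitInterval) (A S : Finset (Fin n)) (b a₀ : Fin n),
      b ∈ A → Disjoint S A → a₀ ∈ A →
      (∀ a ∈ A, (prodBernoulli u).real (openConn a₀ b) ≤ (prodBernoulli u).real (openConn a b)) →
      (prodBernoulli (fun e : Sym2 (Fin n) => if (∀ y ∈ e, y ∈ S) ∧ ¬ e.IsDiag then 1 else u e)).real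
          ((⋃ v ∈ S, ⋃ a ∈ (A.erase b).erase a₀, openConn v a) ∩ openConn a₀ b ∩ ⋂ v ∈ S, (openConn v a₀)ᶜ)
        ≤ (prodBernoulli (fun e : Sym2 (Fin n) => if (∀ y ∈ e, y ∈ S) ∧ ¬ e.IsDiag then 1 else u e)).real
          ((⋃ v ∈ S, openConn v b) ∩ (⋃ v ∈ S, ⋃ a ∈ (A.erase b).erase a₀, openConn v a)
            ∩ ⋂ v ∈ S, (openConn v a₀)ᶜ)) :
    Summit.CriticalPhenomena.PercolationContinuityZ3.Theses.PercNearOneGluingNoHeavy.NoHeavyLowerTail :=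
  noHeavyLowerTail_of_simex hSX

end SimexReduction

end

end Summit.CriticalPhenomena.PercolationContinuityZ3.Theorems
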